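import Literature.NumberTheory.LFunctions.ConreyIwaniec2002RootNumberQuotient
import HarnessLib

/-!
# Conrey–Iwaniec (2002), Lemma 7.5, upper half: `|x(s)| ≪ log q + log t`

Conrey–Iwaniec, *Spacing of zeros of Hecke L-functions and the class number problem*, Acta Arith.
103 (2002), §7 (7.26)–(7.28) [held text `paper:arxiv-math_0111012`, p0018:L83–100]. With
`X(s) = Q^{1−2s}Γ(1−s)/Γ(s)` (7.13), `Q = √q/2π`, and `x(s) = (X(s) − X(s′))/(s − s′)` (7.20)
(`X′(s)` at `s′ = s`), Lemma 7.5 gives `|x(s)| = 2|sin((t−t′)log tQ)/(t−t′)| + O(1/t)`; in §9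
(p. 20, between (9.6) and (9.7)) this is consumed as the UPPER bound `x(s) ≪ log q + log T` for the
points `s = ½ + it`, `T < t ≤ 2T`, with arbitrary companions `s′ = ½ + it′`.

PROVED HERE (no named fact): for `q > 4`, `t ≥ 2` and EVERY real `t′`,
`‖x(s)‖ ≤ C(log q + log t)` with an absolute `C` (`ConreyIwaniec2002.norm_xQuot_le`).
Ingredients, all from `ConreyIwaniec2002RootNumberQuotient` / `ConreyIwaniec2002SpacingMechanism`:
`|X(½+iu)| = 1` (`norm_afeX_half`), the derivative `X′(s) = X(s)(−2 log Q − ψ(1−s) − ψ(s))`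
(`hasDerivAt_afeX`, `hasDerivAt_afeX_line`), `|log Q| ≤ ½ log q + 2` (`abs_log_condQ_le`) and the
vertical Stirling bound `ψ(½ + iy) = log(1+|y|) + O(1)` (`exists_norm_digamma_half_line_sub_log_le`,
`norm_digamma_sub_log_le_of_near`). Cases: `|t − t′| ≥ 1` (then `|x| ≤ 2`), `t′ = t` (the
derivative), and `0 < |t − t′| < 1` (mean value inequality on `[t′, t]`, where
`|X′(½+iv)| ≤ 2|log Q| + 2(C₀ + 1) + 2 log t`).

This is stub S3 `stub_norm_xQuot_le` of the `ls-inputs` skeleton I6b (line `prop81-moebius-perron`)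
for Proposition 9.1 of the paper, with the registered signature verbatim. Nothing about zeros of
`L`-functions is asserted here.

## References

* [ConreyIwaniec2002] B. Conrey, H. Iwaniec, Acta Arith. 103 (2002) 259–312, arXiv:math/0111012:
  §7 (7.13), (7.20), (7.26)–(7.28) (Lemma 7.5); §9 p. 20.
-/

noncomputable section

open Complex

namespace Literature.NumberTheory.LFunctions

namespace ConreyIwaniec2002

/-- The logarithmic derivative of `X` along the critical line is `O(log q + log t)` near `t ≥ 2`:
for `|v − t| < 1`, `‖−2 log Q − ψ(1 − (½+iv)) − ψ(½+iv)‖ ≤ 2|log Q| + 2(C₀ + 1) + 2 log t`, where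
`C₀` is any vertical Stirling constant for `ψ` on the line `Re = ½`.
[cite: ConreyIwaniec2002, Lemma 7.5 (7.27)] -/
theorem norm_logDeriv_afeX_line_le {C₀ : ℝ}
    (hC₀ : ∀ y : ℝ, ‖digamma (1 / 2 + y * I) - Real.log (1 + |y|)‖ ≤ C₀)
    (q : ℕ) {t v : ℝ} (ht : 2 ≤ t) (hv : |v - t| < 1) :
    ‖-(2 * (Real.log (condQ q) : ℂ)) - digamma (1 - (1 / 2 + v * I)) - digamma (1 / 2 + v * I)‖ ≤
      2 * |Real.log (condQ q)| + 2 * (C₀ + 1) + 2 * Real.log t := by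
  have hv0 : 0 < v := by linarith [neg_abs_le (v - t)]
  have hlogt : 0 < Real.log t := Real.log_pos (by linarith)
  have h1s : (1 : ℂ) - (1 / 2 + (v : ℂ) * I) = 1 / 2 + ((-v : ℝ) : ℂ) * I := by push_cast; ring
  have hdecomp : -(2 * (Real.log (condQ q) : ℂ)) - digamma (1 - (1 / 2 + (v : ℂ) * I)) -
      digamma (1 / 2 + (v : ℂ) * I) =
      ((-(2 * Real.log (condQ q) + 2 * Real.log t) : ℝ) : ℂ) -
        ((digamma (1 / 2 + ((-v : ℝ) : ℂ) * I) - Real.log t) +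
          (digamma (1 / 2 + (v : ℂ) * I) - Real.log t)) := by
    rw [h1s]; push_cast; ring
  have hψ1 := norm_digamma_sub_log_le_of_near hC₀ ht hv (-v) (by rw [abs_neg, abs_of_pos hv0])
  have hψ2 := norm_digamma_sub_log_le_of_near hC₀ ht hv v (abs_of_pos hv0)
  have hA : ‖((-(2 * Real.log (condQ q) + 2 * Real.log t) : ℝ) : ℂ)‖ ≤
      2 * |Real.log (condQ q)| + 2 * Real.log t := by
    rw [Complex.norm_real, Real.norm_eq_abs, abs_neg, abs_le]
    constructor <;>
      linarith [neg_abs_le (Real.log (condQ q)), le_abs_self (Real.log (condQ q))]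
  have hB : ‖(digamma (1 / 2 + ((-v : ℝ) : ℂ) * I) - Real.log t) +
      (digamma (1 / 2 + (v : ℂ) * I) - Real.log t)‖ ≤ 2 * (C₀ + 1) :=
    (norm_add_le _ _).trans (by linarith)
  rw [hdecomp]
  exact (norm_sub_le _ _).trans (by linarith)

/-- **Lemma 7.5, upper half.** There is an absolute constant `C > 0` such that for `q > 4`,
`s = ½ + it` with `t ≥ 2`, and every companion `s′ = ½ + it′` (`t′ ∈ ℝ` arbitrary),
`|x(s)| ≤ C(log q + log t)`, where `x(s) = (X(s) − X(s′))/(s − s′)` (`X′(s)` when `s′ = s`),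
`X(s) = Q^{1−2s}Γ(1−s)/Γ(s)`, `Q = √q/2π`. (From `|X| = 1` on the critical line and
`|X′(½+iu)| ≤ 2|log Q| + |ψ(½−iu)| + |ψ(½+iu)| ≪ log q + log(2+|u|)`; the paper states the sharper
asymptotic `|x(s)| = 2|sin((t−t′)log tQ)/(t−t′)| + O(1/t)` for `t, t′ ≥ 1` and uses
`x(s) ≪ log q + log T` on p. 20.) [cite: ConreyIwaniec2002, Lemma 7.5 (7.26)–(7.28); §9 p. 20] -/
theorem norm_xQuot_le :
    ∃ C : ℝ, 0 < C ∧ ∀ q : ℕ, 4 < q → ∀ t t' : ℝ, 2 ≤ t →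
      ‖xQuot q (1 / 2 + t * I) (1 / 2 + t' * I)‖ ≤ C * (Real.log q + Real.log t) := by
  obtain ⟨C₀, hC₀0, hC₀⟩ := exists_norm_digamma_half_line_sub_log_le
  refine ⟨7 + 2 * C₀, by positivity, fun q hq t t' ht => ?_⟩
  have hq0 : 0 < q := by omega
  have hq5 : (5 : ℝ) ≤ q := by exact_mod_cast hq
  have hℓ1 : 1 ≤ Real.log q := by
    rw [Real.le_log_iff_exp_le (by linarith)]
    exact Real.exp_one_lt_d9.le.trans (by linarith)
  have ht0 : 0 < t := by linarith
  have hlogt : 0 < Real.log t := Real.log_pos (by linarith)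
  have hQ := abs_log_condQ_le hq0
  -- the derivative bound `2|log Q| + 2(C₀+1) + 2 log t` and the trivial bound `2` are both
  -- `≤ (7 + 2C₀)(log q + log t)`
  have hBle : 2 * |Real.log (condQ q)| + 2 * (C₀ + 1) + 2 * Real.log t ≤
      (7 + 2 * C₀) * (Real.log q + Real.log t) := by
    nlinarith [mul_nonneg hC₀0 (sub_nonneg.mpr hℓ1), mul_nonneg hC₀0 hlogt.le]
  have h2le : (2 : ℝ) ≤ (7 + 2 * C₀) * (Real.log q + Real.log t) := by
    nlinarith [mul_nonneg hC₀0 (sub_nonneg.mpr hℓ1), mul_nonneg hC₀0 hlogt.le]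
  -- Case 1: coincident companions, `x(s) = X′(s)`
  by_cases heq : t' = t
  · rw [heq]
    have hs0 : 0 < ((1 / 2 : ℂ) + (t : ℂ) * I).re := by simp
    have hs1 : ((1 / 2 : ℂ) + (t : ℂ) * I).re < 1 := by norm_num
    have hder := (hasDerivAt_afeX hq0 hs0 hs1).deriv
    rw [xQuot_self, hder, norm_mul, norm_afeX_half q hq0, one_mul]
    have hmain := norm_logDeriv_afeX_line_le hC₀ q ht (v := t) (by simp)
    exact hmain.trans hBle
  -- Otherwise `x(s) = (X(s) − X(s′))/(s − s′)` with `‖s − s′‖ = |t − t′| > 0`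
  have hne : t - t' ≠ 0 := sub_ne_zero.mpr (Ne.symm heq)
  have habs0 : 0 < |t - t'| := abs_pos.mpr hne
  have hss' : (1 / 2 + (t' : ℂ) * I) ≠ 1 / 2 + (t : ℂ) * I := by
    intro h
    have := congrArg Complex.im h
    simp at this
    exact heq this
  have hnorm_ss' : ‖(1 / 2 + (t : ℂ) * I) - (1 / 2 + (t' : ℂ) * I)‖ = |t - t'| := by
    rw [show (1 / 2 + (t : ℂ) * I) - (1 / 2 + (t' : ℂ) * I) = ((t - t' : ℝ) : ℂ) * I by
      push_cast; ring]
    rw [norm_mul, Complex.norm_I, mul_one, Complex.norm_real, Real.norm_eq_abs]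
  rw [xQuot_of_ne q hss', norm_div, hnorm_ss', div_le_iff₀ habs0]
  -- Case 2: far companions, `|t − t′| ≥ 1`: `|X(s) − X(s′)| ≤ 2`
  by_cases hfar : 1 ≤ |t - t'|
  · have h2 : ‖afeX q (1 / 2 + t * I) - afeX q (1 / 2 + t' * I)‖ ≤ 2 := by
      calc ‖afeX q (1 / 2 + t * I) - afeX q (1 / 2 + t' * I)‖
          ≤ ‖afeX q (1 / 2 + t * I)‖ + ‖afeX q (1 / 2 + t' * I)‖ := norm_sub_le _ _
        _ = 2 := by rw [norm_afeX_half q hq0, norm_afeX_half q hq0]; norm_num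
    calc ‖afeX q (1 / 2 + t * I) - afeX q (1 / 2 + t' * I)‖ ≤ 2 * 1 := by linarith
      _ ≤ (7 + 2 * C₀) * (Real.log q + Real.log t) * |t - t'| :=
          mul_le_mul h2le hfar zero_le_one (by linarith)
  -- Case 3: close distinct companions, `0 < |t − t′| < 1`: the mean value inequality on `[t′, t]`
  push Not at hfar
  have hA_bound : ∀ v ∈ Set.uIcc t' t,
      ‖afeX q (1 / 2 + v * I) *
        (-(2 * (Real.log (condQ q) : ℂ)) - digamma (1 - (1 / 2 + v * I)) - digamma (1 / 2 + v * I)) *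
        I‖ ≤ 2 * |Real.log (condQ q)| + 2 * (C₀ + 1) + 2 * Real.log t := by
    intro v hv
    have hvt : |v - t| < 1 := by
      have h := Set.abs_sub_right_of_mem_uIcc hv
      rw [abs_sub_comm] at h
      exact lt_of_le_of_lt h hfar
    rw [norm_mul, norm_mul, norm_afeX_half q hq0, Complex.norm_I, one_mul, mul_one]
    exact norm_logDeriv_afeX_line_le hC₀ q ht hvt
  have hMV := Convex.norm_image_sub_le_of_norm_hasDerivWithin_le
    (f := fun v : ℝ => afeX q (1 / 2 + v * I))
    (fun v _ => (hasDerivAt_afeX_line hq0 v).hasDerivWithinAt) hA_bound (convex_uIcc t' t)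
    Set.left_mem_uIcc Set.right_mem_uIcc
  -- `hMV : ‖X(s) − X(s′)‖ ≤ (2|log Q| + 2(C₀+1) + 2 log t) ‖t − t′‖`
  rw [Real.norm_eq_abs] at hMV
  exact hMV.trans (mul_le_mul_of_nonneg_right hBle (abs_nonneg _))

end ConreyIwaniec2002

end Literature.NumberTheory.LFunctions

end
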